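import Literature.MathematicalPhysics.QuantumFieldTheory.Balaban1983to89.T3AlphaInputsACTwoRunLevel
import Mathlib.Analysis.SpecialFunctions.Pow.Real
import Mathlib.Analysis.SpecialFunctions.Log.Basic
import HarnessLib

/-!
# Ideator 2 (seat `ym-cruxidea-19201-2`, gen 5, NEGATION lens) — TYPED ARITHMETIC of FINDING N6 «the marginal channel of the two-cut-off comparison»
# crux `FluctuationComparisonRegPr` (stmt-QuantumFields-19201, aside) / live twin `FluctuationComparisonRegPrL` (stmt-QuantumFields-19935),
# skeleton v5h STUB 3′ `stub_alphaTwoRunOfLane` (`∃ a > 0`), located-UNPRINTED row `T3AlphaInputsACTwoRunLevel.PolymerCauchyMinAt` (rate `(L^{1+j})^{-a}`,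
# ∀ heights `n ≤ K`), landed consumer `LogComparisonLevelCauchyMin.levelCauchyOfTwoRunMin_dec` (uses `b = min(a,1)`).

Pure real arithmetic; sorry-free; nothing of Bałaban's, King's or Moore's is asserted.

N6 in one paragraph.  In d = 3 the only non-contracting (marginal) direction of the small-field flow is the `tr F²` coefficient; the two unimproved Wilson runs with
cut-offs `η_K` and `η_K/L` realise continuum couplings that differ by the RELATIVE amount `δ_K = (c_N/4π)·(1 − 1/L)·g²η_K`, `c_2 = 5π/9 + 2(37ξ/12 − π/9) = 1.98983`
(`ξ = 0.152859325`), i.e. `δ_K = 0.15835·(1 − 1/L)·g²η_K` for SU(2) — the one-loop ADDITIVE β-shift `β_L = 4/(g²a) + 0.6334` of 3-d lattice perturbation theory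
[Moore 1998, NPB 523, hep-lat/9709053, eq. (gaugerenorm) p.8, lattice action p.7, «interpret the true lattice spacing as Z_g⁻¹ a_n», «Z_g < 1» pp.10–11].  This marginal
discrepancy is (i) born at the finer run's UNPAIRED finest level as a one-loop, g-independent, V-dependent term `c₁b₁η∫tr F²(U(V))` — booked by SIZE (`TermSizeTriv`) in the
consumer, cost `O(γL^{-K})` per datum cell, summable — and (ii) fed into the PAIRED levels only through their g-dependent (two-loop) parts, relative size
`c·δ_K·g_i² ≍ c·γ²·L^{i−2K}` at paired level `i` (counted from the cut-off), against the row's allowance `C·L^{−a·i}`.  Consequences (this file):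
* `rate_le_one_of_marginalFloor` (§1, PROVED): a level-INDEPENDENT floor `c·x⁻¹ ≤ C·(x⁻¹)^a` along `x = L^K → ∞` forces `a ≤ 1` — the typed row (which quantifies over ALL
  heights `n ≤ K`, hence over the paired level `i = K`, where the marginal feedback is `≍ cγ²·L^{-K}`) is FALSE for every exponent `a > 1` unless the marginal constant vanishes;
  MOOT for the line: the landed consumer already reads `b = min(a,1)` and STUB 3′ asks `∃ a > 0`.
* `twoTerm_fits_rate_one` (§2, PROVED): the natural TWO-TERM shape `L^{−2i}` (irrelevant channel, King-faithful `a = 2`) `+ γ²L^{i−2K}` (marginal feedback) fits the single-power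
  row with `a = 1` (constant 2) at every paired level `i ≤ K` — so `a = 1` is exactly the borderline, the classical/irrelevant channels' `a = 2` (sibling card
  `e1-second-order-kantorovich`, C4's germ) does NOT lift to the stochastic row, and nothing is lost by it.
* R-C4-4 of card C4 (`cutoff-pencil-cauchy`) is closed by QUANTIFIER ORDER, not by constants: `rate_of_response_le` (§3, PROVED) — for any target `a < 1` the feedback ratio
  `(C_* + 1)/L ≤ L^{−a}` holds as soon as the response constant `C_* ≤ L^{1−a} − 1`, and `C_* = O(γ^{1/2}·B(L)/ε₀) → 0` under `γ ≤ γ₁(L, 𝔠, ε₀)` — which v5h's order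
  `∃ a, ∀ ε₀, ∃ γ₁, ∀ γ ≤ γ₁` permits (fix `a = 1/2`, shrink `γ₁`).
* §4 (TYPED OVER THE TREE's ROW, PROVED): `PolymerCauchyMinAtTwoTerm` = the registered row `T3AlphaInputsACTwoRunLevel.PolymerCauchyMinAt` with the single-power
  artefact factor `((L^{1+j})⁻¹)^a` replaced by the two-term factor `(L^{2(1+j)})⁻¹ + γ²L^{1+j}(L^{2K})⁻¹` (binders byte-identical otherwise), and the ADAPTER
  `polymerCauchyMinAt_one_of_twoTerm : PolymerCauchyMinAtTwoTerm D b₀ p₀ κ₁ C → PolymerCauchyMinAt D b₀ p₀ κ₁ 1 (2·C)` (`0 ≤ C`, `1 ≤ L`, `0 ≤ γ ≤ 1`) — so a STUB 3′ pen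
  who finds the channel-wise row easier to discharge loses nothing downstream (`TwoRunMin … 1`, consumer `b = 1`, `m₀ = 5`).
-/

noncomputable section

namespace Summit.QuantumFields.YangMills.Cruxes.FluctuationComparisonRegPr.Ideate2Gen5

/-! ## §1 A level-independent marginal floor caps any single-power rate at `a ≤ 1` — PROVED -/

/-- **RATE CAP FROM A MARGINAL FLOOR.** If `1 < L`, `0 < c` and for every cut-off `K` the floor `c·(L^K)⁻¹` lies below the allowance `C·((L^K)⁻¹)^a`,
then `a ≤ 1`.  (Read at the paired level `i = K` of `PolymerCauchyMinAt`: floor = marginal two-loop feedback `≍ cγ²L^{-K}`, allowance = `C·(L^{-K})^a`.) -/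
theorem rate_le_one_of_marginalFloor {L c C a : ℝ} (hL : 1 < L) (hc : 0 < c)
    (h : ∀ K : ℕ, c * (L ^ K)⁻¹ ≤ C * ((L ^ K)⁻¹) ^ a) : a ≤ 1 := by
  by_contra ha
  push Not at ha
  have hL0 : 0 < L := by linarith
  have hC : 0 < C := by
    have h0 := h 0
    simp at h0
    linarith
  have hlogL : 0 < Real.log L := Real.log_pos hL
  have key : ∀ K : ℕ, (a - 1) * K * Real.log L ≤ Real.log C - Real.log c := by
    intro K
    have hx : 0 < (L ^ K : ℝ) := pow_pos hL0 K
    have hK := h K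
    have hlhs : 0 < c * (L ^ K : ℝ)⁻¹ := mul_pos hc (inv_pos.mpr hx)
    have hlog := Real.log_le_log hlhs hK
    have e1 : Real.log (c * (L ^ K : ℝ)⁻¹) = Real.log c - K * Real.log L := by
      rw [Real.log_mul hc.ne' (inv_pos.mpr hx).ne', Real.log_inv, Real.log_pow]
      ring
    have hxa : 0 < ((L ^ K : ℝ)⁻¹) ^ a := Real.rpow_pos_of_pos (inv_pos.mpr hx) a
    have e2 : Real.log (C * ((L ^ K : ℝ)⁻¹) ^ a) = Real.log C - a * (K * Real.log L) := by
      rw [Real.log_mul hC.ne' hxa.ne', Real.log_rpow (inv_pos.mpr hx), Real.log_inv, Real.log_pow]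
      ring
    rw [e1, e2] at hlog
    nlinarith [hlog]
  have hden : 0 < (a - 1) * Real.log L := mul_pos (by linarith) hlogL
  obtain ⟨K, hK⟩ := exists_nat_gt ((Real.log C - Real.log c) / ((a - 1) * Real.log L))
  have hkey := key K
  have : (K : ℝ) ≤ (Real.log C - Real.log c) / ((a - 1) * Real.log L) := by
    rw [le_div_iff₀ hden]
    calc (K : ℝ) * ((a - 1) * Real.log L) = (a - 1) * K * Real.log L := by ring
      _ ≤ Real.log C - Real.log c := hkey
  linarith

/-- The cap is attained: with `a = 1` a floor `c·x⁻¹` is an allowance (`C = c`). -/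
theorem marginalFloor_fits_rate_one {L c : ℝ} (K : ℕ) :
    c * (L ^ K)⁻¹ ≤ c * ((L ^ K)⁻¹) ^ (1 : ℝ) := by
  rw [Real.rpow_one]

/-! ## §2 The two-term row fits the single-power row with `a = 1` — PROVED -/

/-- **TWO-TERM ⇒ SINGLE POWER `a = 1`.** For `1 ≤ L`, a paired level `i ≤ K` and `γ² ≤ 1`: irrelevant channel `(L^{2i})⁻¹` plus marginal feedback
`γ²·Lⁱ·(L^{2K})⁻¹` is at most `2·(Lⁱ)⁻¹`. -/
theorem twoTerm_fits_rate_one {L γ : ℝ} {i K : ℕ} (hL : 1 ≤ L) (hiK : i ≤ K) (hγ0 : 0 ≤ γ) (hγ : γ ≤ 1) :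
    (L ^ (2 * i))⁻¹ + γ ^ 2 * L ^ i * (L ^ (2 * K))⁻¹ ≤ 2 * (L ^ i)⁻¹ := by
  have hL0 : 0 < L := by linarith
  have hLi : 0 < L ^ i := pow_pos hL0 i
  have hL2i : 0 < L ^ (2 * i) := pow_pos hL0 (2 * i)
  have hL2K : 0 < L ^ (2 * K) := pow_pos hL0 (2 * K)
  -- irrelevant channel: (L^{2i})⁻¹ ≤ (L^i)⁻¹
  have h1 : (L ^ (2 * i))⁻¹ ≤ (L ^ i)⁻¹ := by
    apply inv_anti₀ hLi
    exact pow_le_pow_right₀ hL (by omega)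
  -- marginal channel: γ²·Lⁱ/L^{2K} ≤ 1/Lⁱ
  have hγ2 : γ ^ 2 ≤ 1 := by nlinarith
  have h2 : γ ^ 2 * L ^ i * (L ^ (2 * K))⁻¹ ≤ (L ^ i)⁻¹ := by
    rw [← div_eq_mul_inv, ← one_div, div_le_div_iff₀ hL2K hLi]
    have hpow : L ^ i * L ^ i ≤ L ^ (2 * K) := by
      rw [← pow_add]
      exact pow_le_pow_right₀ hL (by omega)
    have : γ ^ 2 * L ^ i * L ^ i ≤ 1 * (L ^ i * L ^ i) := by
      rw [mul_assoc]
      exact mul_le_mul_of_nonneg_right hγ2 (by positivity)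
    linarith
  linarith

/-! ## §3 R-C4-4 closed by quantifier order — PROVED -/

/-- **RESPONSE CONSTANT vs TARGET EXPONENT.** For `1 < L`, a target exponent `a` and a response constant `C_*` with `C_* + 1 ≤ L^{1−a}`,
the feedback ratio satisfies `(C_* + 1)/L ≤ L^{−a}` (so C4's recursion `rel_k ≤ M((C_*+1)/L)^k` delivers the row with exponent `a`).  Since
`C_* → 0` as `γ₁ → 0` at fixed `(L, 𝔠, ε₀)`, any `a < 1` is reachable under v5h's order `∃ a, ∀ ε₀, ∃ γ₁`. -/
theorem rate_of_response_le {L Cstar a : ℝ} (hL : 1 < L) (hCa : Cstar + 1 ≤ L ^ (1 - a)) :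
    (Cstar + 1) / L ≤ L ^ (-a) := by
  have hL0 : 0 < L := by linarith
  rw [div_le_iff₀ hL0]
  calc Cstar + 1 ≤ L ^ (1 - a) := hCa
    _ = L ^ (-a) * L := by
      rw [sub_eq_neg_add, Real.rpow_add hL0, Real.rpow_one, mul_comm]

/-- … and the threshold is non-vacuous: for `a < 1`, `L^{1−a} − 1 > 0`, so SOME positive response constant is admissible. -/
theorem response_threshold_pos {L a : ℝ} (hL : 1 < L) (ha : a < 1) : 0 < L ^ (1 - a) - 1 := by
  have : (1 : ℝ) < L ^ (1 - a) := Real.one_lt_rpow hL (by linarith)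
  linarith

/-! ## §4 The two-term row, typed over the tree's `PolymerCauchyMinAt`, and its adapter to exponent `a = 1` — PROVED -/

section TwoTermRow

open Literature.MathematicalPhysics.QuantumFieldTheory.Balaban1983to89
open Literature.MathematicalPhysics.QuantumFieldTheory.Balaban1983to89.T3ContinuumYM3Torus
open Literature.MathematicalPhysics.QuantumFieldTheory.Balaban1983to89.T3UnitScaleTilt
open Literature.MathematicalPhysics.QuantumFieldTheory.Balaban1983to89.T3LevelShift
open Literature.MathematicalPhysics.QuantumFieldTheory.Balaban1983to89.T3AlphaInputsAC
open Literature.MathematicalPhysics.QuantumFieldTheory.Balaban1983to89.T3AlphaPolymerSocket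
open Literature.MathematicalPhysics.QuantumFieldTheory.Balaban1983to89.T3AlphaInputsACTwoRun
open Literature.MathematicalPhysics.QuantumFieldTheory.Balaban1983to89.T3AlphaInputsACTwoRunLevel

variable {F : T3Family} {γ : ℝ}

/-- **THE CHANNEL-WISE (TWO-TERM) CUT-OFF COMPARISON ROW** (hypothesis schema, never asserted): `PolymerCauchyMinAt` with the single-power relative
artefact `((L^{1+j})⁻¹)^a` of the level-`(1+j)` object replaced by IRRELEVANT `(L^{2(1+j)})⁻¹` (King's `a = 2` from the cut-off) PLUS MARGINAL FEEDBACK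
`γ²·L^{1+j}·(L^{2K})⁻¹` (two-loop × Moore's one-loop β-shift, N6 §2b).  Everything else byte-identical to the tree's row. -/
def PolymerCauchyMinAtTwoTerm (D : AlphaDataT3 F γ) (b₀ p₀ κ₁ C : ℝ) : Prop :=
  ∃ c : (K n j : ℕ) → Set (Site (F.P K) 0) → ℝ,
    ∀ (K n : ℕ) (h : n ≤ K), ∀ j : ℕ, j < K - n →
      ∀ V : GaugeField (F.P n) 0 (Matrix.specialUnitaryGroup (Fin 2) ℂ), PlaqSmall (θBal F.L γ b₀ p₀ n) V →
        ∀ Y ∈ D.Loc K (K - n) (D.triv K (K - n)) (1 + j),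
          |D.Pterm (K + 1) (1 + (j + 1)) (refineSet F K Y) (D.Umin (K + 1) (K + 1 - n) (D.triv (K + 1) (K + 1 - n))
              (fieldShift (F.sitesPerDir_eq (m := F.m) (K := K + 1) (j := K + 1 - n) (m' := F.m) (K' := n) (j' := 0) (by omega)) V)) -
            D.Pterm K (1 + j) Y (D.Umin K (K - n) (D.triv K (K - n))
              (fieldShift (F.sitesPerDir_eq (m := F.m) (K := K) (j := K - n) (m' := F.m) (K' := n) (j' := 0) (by omega)) V)) -
            c K n j Y| ≤
          C * Real.exp (-κ₁ * D.treeLen K (1 + j) Y) * θBal F.L γ b₀ p₀ n ^ 2 *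
            (((F.L : ℝ) ^ (K - n - 1 - j))⁻¹) ^ 4 *
            (((F.L : ℝ) ^ (2 * (1 + j)))⁻¹ + γ ^ 2 * (F.L : ℝ) ^ (1 + j) * ((F.L : ℝ) ^ (2 * K))⁻¹)

/-- **ADAPTER (PROVED): the two-term row implies the registered single-power row with `a = 1` and constant `2C`** — by `twoTerm_fits_rate_one`
at the paired level `i = 1 + j ≤ K`.  Hypotheses: `0 ≤ C`, `1 ≤ L`, `0 ≤ γ ≤ 1` (the crux serves `0 < γ ≤ γ₁ ≤ 1`). -/
theorem polymerCauchyMinAt_one_of_twoTerm (D : AlphaDataT3 F γ) {b₀ p₀ κ₁ C : ℝ} (hC : 0 ≤ C)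
    (hL : 1 ≤ (F.L : ℝ)) (hγ0 : 0 ≤ γ) (hγ1 : γ ≤ 1)
    (h : PolymerCauchyMinAtTwoTerm D b₀ p₀ κ₁ C) : PolymerCauchyMinAt D b₀ p₀ κ₁ 1 (2 * C) := by
  obtain ⟨c, hc⟩ := h
  refine ⟨c, ?_⟩
  intro K n hn j hj V hV Y hY
  have hrow := hc K n hn j hj V hV Y hY
  have hjK : 1 + j ≤ K := by omega
  have htt := twoTerm_fits_rate_one (L := (F.L : ℝ)) (γ := γ) (i := 1 + j) (K := K) hL hjK hγ0 hγ1
  -- the common nonnegative prefactor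
  have hpre : 0 ≤ C * Real.exp (-κ₁ * D.treeLen K (1 + j) Y) * θBal F.L γ b₀ p₀ n ^ 2 *
      (((F.L : ℝ) ^ (K - n - 1 - j))⁻¹) ^ 4 := by positivity
  have hmul := mul_le_mul_of_nonneg_left htt hpre
  rw [Real.rpow_one]
  calc _ ≤ _ := hrow
    _ ≤ C * Real.exp (-κ₁ * D.treeLen K (1 + j) Y) * θBal F.L γ b₀ p₀ n ^ 2 *
          (((F.L : ℝ) ^ (K - n - 1 - j))⁻¹) ^ 4 * (2 * ((F.L : ℝ) ^ (1 + j))⁻¹) := hmul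
    _ = 2 * C * Real.exp (-κ₁ * D.treeLen K (1 + j) Y) * θBal F.L γ b₀ p₀ n ^ 2 *
          (((F.L : ℝ) ^ (K - n - 1 - j))⁻¹) ^ 4 * ((F.L : ℝ) ^ (1 + j))⁻¹ := by ring

end TwoTermRow

end Summit.QuantumFields.YangMills.Cruxes.FluctuationComparisonRegPr.Ideate2Gen5

end
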